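/-
Copyright: rh-split cell (screw, bridge) gen 19, 2026-08-28.  Splitting search over kernel-typed
RH-equivalences.  A splitting `A ∧ B ⟹ RH` is CONDITIONAL bookkeeping unless `A` and `B` are both
proved; nothing here bears on the truth of RH.
-/
import Summits.RiemannHypothesis.RiemannHypothesis.Theorems.Splittings.SlidingTheftGermTower

/-!
# «SLIDING THEFT GERM» — K7′ «removal + sliding»: the typed identity and its necessary condition

§14 (the K7′ half of lead RULING #462's lane text, keyed as file R by RULING #485; theory-1 K7-AUDIT-v2 §1a (L) /
25.17 (a)).  Over the tree's `Config.psi`, ζ-free: `theftTerm γ η rem t k` (a REMOVED index contributes `−g(γ_k,t)`,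
a kept one its slide);
`RemovalSlidingTheft U η̄ A Z γ η rem` = (H1) finitary + ordinates `≥ 1` + slides `≤ η̄` +
`HasSum (theftTerm …) (−Ψ_Z t)` on `|t| ≤ U` (pure sliding = `rem ≡ false`,
`removalSlidingTheft_of_boundedSlidingTheft`); `smoothCount γ Y F` = `#{k ∈ F : γ_k ≤ Y} + 4Y²·Σ_{k∈F, γ_k>Y} γ_k⁻²`;
`sum_pairTrace_le_smoothCount` (removed mass `≤ t²·smoothCount` at `Y = 1/t`);
`sum_theftTerm_ge` (every partial sum `≥ −(601Aη̄t²log(1/t) + M t²)`); **`removedCount_ge_of_removalSlidingTheft`** —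
the COUNT THEFT LAW WITH REMOVAL, one-sided: under `GermHyp`, for `Y ≥ max(4, 1/U)`, if every finite set of removed
indices has smoothed count `≤ M` at `Y` then
`(43/24)·Σ_{unresolved atoms below Y} m₁ ≤ M + 601·A·η̄·log Y + 20σ*²A_Z`;
**`superlog_removal_of_removalSlidingTheft`** — a theft of a `SuperlogTower` removes super-logarithmically many zeros
(finite removed sets of smoothed count `> C log Y`, cofinally in `Y`, for every `C`); non-vacuity / instances:
`removalSlidingTheft_emptyConfig` (the trivial theft of the empty configuration) and `superlog_removal_towerConfig`
(the price instantiated on §13's genuine tower — hence the import of `SlidingTheftGermTower`).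
THIS DOES NOT DECIDE B33 Q_C clause 3 / K7′: whether removal sets of this size WITH bounded slides reproducing `Ψ_Z`
exist is the open CONSTRUCTION question (rh-idea-4's side; theory-1 25.22 numerics of record give design constants
only: redundancy r ≥ 3, Dcut ≈ 10 spacings, remove the nearest zero on each side).
NOT HERE: the exact two-sided exchange «removed count = 2·N_Z(Y) + O(log Y)» and its upper half (over-removal has no
twin: theory-1 25.17 / K7-COUNT-LAW-2SIDED 48c9a1a6, paper; 25.22 (C) illustrates THAT half, not this theorem).

HONEST LABEL: elementary real analysis + finite-sum bookkeeping; an INSTRUMENT (necessary condition for another seat's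
conjectured mechanism); ζ-free, RH-free; toward RH: 0.  Nothing here bears on the truth of RH.
-/

set_option linter.dupNamespace false

namespace Summit.RiemannHypothesis.RiemannHypothesis.Theorems.Splittings.SlidingGerm

open Summit.RiemannHypothesis.RiemannHypothesis.Theorems.Splittings.ScrewLatticeTower

/-! ## 14. K7′ «removal + sliding»: the typed identity over `Config.psi` and its necessary condition
(the COUNT THEFT LAW WITH REMOVAL, one-sided, smoothed removed count) -/

/-- The K7′ summand: a REMOVED index contributes `−g(γ_k, t)` (its pair is missing on the zero side), a kept
index contributes its slide `g(γ_k + η_k, t) − g(γ_k, t)`. -/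
noncomputable def theftTerm (γ η : ℕ → ℝ) (rem : ℕ → Bool) (t : ℝ) (k : ℕ) : ℝ :=
  if rem k then -pairTrace (γ k) t else pairTrace (γ k + η k) t - pairTrace (γ k) t

/-- **K7′ «REMOVAL + SLIDING THEFT»** of the configuration `Z` on the window `|t| ≤ U` by the ordinates `γ`
(counted by (H1) with constant `A`, all `≥ 1`), the slides `η` (bounded by `η̄`) and the removed set `rem`:
`Σ_k theftTerm = −Ψ_Z(t)` as a convergent series for every `|t| ≤ U` — the prime side cannot tell the slid and
thinned zeros plus the off-line tower `Z` from the original zeros.  Pure sliding is `rem ≡ false`. -/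
def RemovalSlidingTheft (U ηbar A : ℝ) (Z : Config) (γ η : ℕ → ℝ) (rem : ℕ → Bool) : Prop :=
  CountHyp A γ ∧ (∀ k, 1 ≤ γ k) ∧ (∀ k, |η k| ≤ ηbar) ∧
    ∀ t : ℝ, |t| ≤ U → HasSum (theftTerm γ η rem t) (-(Z.psi t))

/-- Pure sliding is the special case `rem ≡ false` of K7′. -/
theorem removalSlidingTheft_of_boundedSlidingTheft {U ηbar A : ℝ} {Z : Config}
    (h : BoundedSlidingTheft U ηbar A Z) :
    ∃ γ η : ℕ → ℝ, RemovalSlidingTheft U ηbar A Z γ η fun _ ↦ false := by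
  obtain ⟨γ, η, hA, hγ, hη, hid⟩ := h
  refine ⟨γ, η, hA, hγ, hη, fun t ht ↦ ?_⟩
  have h := hid t ht
  simp only [two_mul_sub_eq_pairTrace] at h
  have hf : theftTerm γ η (fun _ ↦ false) t = fun k ↦ pairTrace (γ k + η k) t - pairTrace (γ k) t :=
    funext fun k ↦ by simp [theftTerm]
  rw [hf]
  exact h

/-- The SMOOTHED COUNT at height `Y` of a finite set of indices: those with `γ_k ≤ Y` count `1`, those above
count `4Y²/γ_k²` (the most a resolved removed pair can supply at `t = 1/Y`, in units of `t²`). -/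
noncomputable def smoothCount (γ : ℕ → ℝ) (Y : ℝ) (F : Finset ℕ) : ℝ :=
  ((F.filter fun k ↦ γ k ≤ Y).card : ℝ) + 4 * Y ^ 2 * ∑ k ∈ F with Y < γ k, 1 / γ k ^ 2

/-- `smoothCount ≥ 0`. -/
theorem smoothCount_nonneg (γ : ℕ → ℝ) (Y : ℝ) (F : Finset ℕ) : 0 ≤ smoothCount γ Y F := by
  unfold smoothCount; positivity

/-- REMOVED MASS ≤ `t²·`SMOOTHED COUNT at `Y = 1/t`: `Σ_{k∈F} g(γ_k, t) ≤ t²·smoothCount γ (1/t) F` (`t > 0`,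
ordinates `≥ 1`; `g ≤ t²` below `1/t`, `g ≤ 4/γ²` above). -/
theorem sum_pairTrace_le_smoothCount {γ : ℕ → ℝ} (hγ : ∀ k, 1 ≤ γ k) {t : ℝ} (ht : 0 < t) (F : Finset ℕ) :
    ∑ k ∈ F, pairTrace (γ k) t ≤ t ^ 2 * smoothCount γ (1 / t) F := by
  unfold smoothCount
  rw [← Finset.sum_filter_add_sum_filter_not F (fun k ↦ γ k ≤ 1 / t), mul_add]
  have hnot : F.filter (fun k ↦ ¬ γ k ≤ 1 / t) = F.filter (fun k ↦ 1 / t < γ k) :=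
    Finset.filter_congr fun k _ ↦ not_le
  rw [hnot]
  gcongr with k hk k hk
  · -- near part: each `g ≤ t²`, so the sum is `≤ t² · card`
    calc ∑ k ∈ F with γ k ≤ 1 / t, pairTrace (γ k) t ≤ ∑ k ∈ F with γ k ≤ 1 / t, t ^ 2 :=
          Finset.sum_le_sum fun k _ ↦ pairTrace_le_sq (by linarith [hγ k]) t
      _ = t ^ 2 * ((F.filter fun k ↦ γ k ≤ 1 / t).card : ℝ) := by
          rw [Finset.sum_const, nsmul_eq_mul, mul_comm]
  · -- far part: each `g ≤ 4/γ² = t² · (4 (1/t)² / γ²)`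
    rw [Finset.mul_sum, Finset.mul_sum]
    refine Finset.sum_le_sum fun k _ ↦ ?_
    calc pairTrace (γ k) t ≤ 4 / γ k ^ 2 := pairTrace_le_four_div _ _
      _ = t ^ 2 * (4 * (1 / t) ^ 2 * (1 / γ k ^ 2)) := by field_simp

/-- LOWER BOUND ON EVERY PARTIAL SUM of the K7′ series at `0 < t ≤ 1/4`: slides cost at most
`601 A η̄ t² log(1/t)` ((G2) summed), removals supply at most `t²·M` if every finite set of removed indices has
smoothed count `≤ M` at height `1/t`. -/
theorem sum_theftTerm_ge {A ηbar t M : ℝ} {γ η : ℕ → ℝ} {rem : ℕ → Bool} (hA : CountHyp A γ)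
    (hγ : ∀ k, 1 ≤ γ k) (hη : ∀ k, |η k| ≤ ηbar) (hηbar : ηbar ≤ 1 / 2) (ht : 0 < t) (ht4 : t ≤ 1 / 4)
    (hM : ∀ G : Finset ℕ, (∀ k ∈ G, rem k = true) → smoothCount γ (1 / t) G ≤ M) (F : Finset ℕ) :
    -(601 * A * ηbar * t ^ 2 * Real.log (1 / t) + M * t ^ 2) ≤ ∑ k ∈ F, theftTerm γ η rem t k := by
  rw [← Finset.sum_filter_add_sum_filter_not F (fun k ↦ rem k = true)]
  have h1 : ∑ k ∈ F with rem k = true, theftTerm γ η rem t k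
      = -∑ k ∈ F with rem k = true, pairTrace (γ k) t := by
    rw [← Finset.sum_neg_distrib]
    exact Finset.sum_congr rfl fun k hk ↦ by simp [theftTerm, (Finset.mem_filter.mp hk).2]
  have h2 : ∑ k ∈ F with ¬ rem k = true, theftTerm γ η rem t k
      = ∑ k ∈ F with ¬ rem k = true, (pairTrace (γ k + η k) t - pairTrace (γ k) t) :=
    Finset.sum_congr rfl fun k hk ↦ by simp [theftTerm, (Finset.mem_filter.mp hk).2]
  rw [h1, h2]
  have hrem := sum_pairTrace_le_smoothCount hγ ht (F.filter fun k ↦ rem k = true)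
  have hMG := hM (F.filter fun k ↦ rem k = true) fun k hk ↦ (Finset.mem_filter.mp hk).2
  have hslide := abs_sum_slide_le_of_countHyp hA hγ hη hηbar ht ht4 (F.filter fun k ↦ ¬ rem k = true)
  have hs := neg_abs_le (∑ k ∈ F with ¬ rem k = true, (pairTrace (γ k + η k) t - pairTrace (γ k) t))
  have ht2 : 0 ≤ t ^ 2 := sq_nonneg t
  nlinarith [mul_le_mul_of_nonneg_left hMG ht2]

/-- Limit form: a lower bound on every partial sum bounds the sum from below. -/
theorem ge_of_hasSum_of_sum_ge {f : ℕ → ℝ} {s c : ℝ} (hs : HasSum f s) (hc : ∀ F : Finset ℕ, c ≤ ∑ k ∈ F, f k) :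
    c ≤ s :=
  ge_of_tendsto' hs fun F ↦ hc F

/-- **K7′ NECESSARY CONDITION — THE COUNT THEFT LAW WITH REMOVAL (kernel form, one-sided).**  Under `GermHyp σ* Z`,
a removal + sliding theft on `|t| ≤ U` with slides `≤ η̄ ≤ 1/2` satisfies, at every height `Y ≥ max(4, 1/U)`:
if every finite set of REMOVED indices has smoothed count `≤ M` at `Y`, then for every finite set `s` of atoms
unresolved at `Y` (`‖κ₁ i‖ ≤ Y`)
`(43/24)·Σ_{i∈s} m₁ i ≤ M + 601·A·η̄·log Y + 20·σ*²·A_Z`.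
In words: what the tower shows at the germ must be paid for by REMOVED zeros below (or just above) that height,
up to the sliding slack `O(η̄ log Y)` and the resolved-atom slack `O(σ*² A_Z)`; theory-1's paper form has the
exact exchange «removed count = 2·N_Z(Y) + O(log Y)» (K7-AUDIT-v2 §1a, K7-COUNT-LAW-2SIDED) — here only the
lower bound on removal is typed.  This does NOT decide B33 Q_C clause 3 / K7′: whether removal sets of this
size WITH bounded slides reproducing `Ψ_Z` exist is the open construction question (rh-idea-4's side). -/
theorem removedCount_ge_of_removalSlidingTheft {σs U ηbar A : ℝ} {Z : Config} (hZ : GermHyp σs Z)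
    (hU : 0 < U) (hηbar : ηbar ≤ 1 / 2) {γ η : ℕ → ℝ} {rem : ℕ → Bool}
    (hT : RemovalSlidingTheft U ηbar A Z γ η rem) {Y M : ℝ} (hY4 : 4 ≤ Y) (hYU : 1 / U ≤ Y)
    (hM : ∀ G : Finset ℕ, (∀ k ∈ G, rem k = true) → smoothCount γ Y G ≤ M)
    (s : Finset Z.ι) (hs : ∀ i ∈ s, ‖Z.κ₁ i‖ ≤ Y) :
    43 / 24 * ∑ i ∈ s, Z.m₁ i ≤ M + 601 * A * ηbar * Real.log Y
      + 20 * σs ^ 2 * ∑' i, (Z.m₁ i / (Z.κ₁ i).im ^ 2 + Z.m₂ i / (Z.κ₂ i).im ^ 2) := by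
  obtain ⟨hA, hγ, hη, hid⟩ := hT
  have hYpos : 0 < Y := by linarith
  set t := 1 / Y with ht
  have htpos : 0 < t := by positivity
  have ht4 : t ≤ 1 / 4 := one_div_le_one_div_of_le (by norm_num) hY4
  have ht1 : t ≤ 1 := by linarith
  have htU : |t| ≤ U := by rw [abs_of_pos htpos]; exact (one_div_le hYpos hU).mpr hYU
  have hYt : 1 / t = Y := one_div_one_div Y
  -- every partial sum of the theft series is `≥ −(601 A η̄ t² log Y + M t²)`, hence so is `−Ψ_Z(t)`
  have hM' : ∀ G : Finset ℕ, (∀ k ∈ G, rem k = true) → smoothCount γ (1 / t) G ≤ M := by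
    rw [hYt]; exact hM
  have hlow := ge_of_hasSum_of_sum_ge (hid t htU) (sum_theftTerm_ge hA hγ hη hηbar htpos ht4 hM')
  rw [hYt] at hlow
  have hψ : Z.psi t ≤ 601 * A * ηbar * t ^ 2 * Real.log Y + M * t ^ 2 := by linarith
  -- (G1) at `t` for `s`
  have hs' : ∀ i ∈ s, ‖Z.κ₁ i‖ * t ≤ 1 := fun i hi ↦ by
    rw [ht, ← div_eq_mul_one_div, div_le_one hYpos]; exact hs i hi
  have hG1 := Config.psi_ge_unresolved hZ htpos ht1 s hs'
  have h := hG1.trans hψ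
  have ht2 : 0 < t ^ 2 := by positivity
  by_contra hc
  push Not at hc
  have hc' : 0 < 43 / 24 * ∑ i ∈ s, Z.m₁ i
      - 20 * σs ^ 2 * ∑' i, (Z.m₁ i / (Z.κ₁ i).im ^ 2 + Z.m₂ i / (Z.κ₂ i).im ^ 2)
      - 601 * A * ηbar * Real.log Y - M := by linarith
  nlinarith [mul_pos ht2 hc']

/-- **COROLLARY: A THEFT OF A SUPER-LOGARITHMIC TOWER REMOVES SUPER-LOGARITHMICALLY MANY ZEROS.**  If `Z` is a
`SuperlogTower` under `GermHyp` and `(γ, η, rem)` is a removal + sliding theft of it (slides `≤ η̄ ≤ 1/2`), then for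
every `C` and `Y₀` there are a height `Y ≥ Y₀` and a finite set of removed indices whose smoothed count at `Y`
exceeds `C·log Y`.  (With `rem ≡ false` no such set exists: this is `not_boundedSlidingTheft_of_superlogTower`.) -/
theorem superlog_removal_of_removalSlidingTheft {σs U ηbar A : ℝ} {Z : Config} (hZ : GermHyp σs Z)
    (hU : 0 < U) (hηbar : ηbar ≤ 1 / 2) {γ η : ℕ → ℝ} {rem : ℕ → Bool}
    (hT : RemovalSlidingTheft U ηbar A Z γ η rem) (htower : SuperlogTower Z) (C Y₀ : ℝ) :
    ∃ Y : ℝ, Y₀ ≤ Y ∧ ∃ G : Finset ℕ, (∀ k ∈ G, rem k = true) ∧ C * Real.log Y < smoothCount γ Y G := by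
  by_contra hcon
  push Not at hcon
  set AZ := ∑' i, (Z.m₁ i / (Z.κ₁ i).im ^ 2 + Z.m₂ i / (Z.κ₂ i).im ^ 2) with hAZ
  set C' := 24 / 43 * (C + 601 * A * ηbar + 20 * σs ^ 2 * AZ) with hC'
  obtain ⟨Y, hY, s, hs, hCs⟩ := htower C' (max Y₀ (max 4 (1 / U)))
  have hY0 : Y₀ ≤ Y := le_trans (le_max_left _ _) hY
  have hY4 : 4 ≤ Y := le_trans (le_trans (le_max_left _ _) (le_max_right _ _)) hY
  have hYU : 1 / U ≤ Y := le_trans (le_trans (le_max_right _ _) (le_max_right _ _)) hY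
  have hb := removedCount_ge_of_removalSlidingTheft hZ hU hηbar hT hY4 hYU (fun G hG ↦ hcon Y hY0 G hG) s hs
  obtain ⟨hA, -, hη, -⟩ := hT
  have hA0 : 0 ≤ A := hA.nonneg
  have hη0 : 0 ≤ ηbar := le_trans (abs_nonneg _) (hη 0)
  have hAZ0 : 0 ≤ AZ := by
    rw [hAZ]
    exact tsum_nonneg fun i ↦ by
      obtain ⟨h1, h2⟩ := hZ.m_nonneg i
      positivity
  have hlog : 1 ≤ Real.log Y := by
    rw [← Real.log_exp 1]
    refine Real.log_le_log (Real.exp_pos 1) (le_trans ?_ hY4)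
    have := Real.exp_one_lt_d9
    linarith
  have hmono : 24 / 43 * (C * Real.log Y + 601 * A * ηbar * Real.log Y + 20 * σs ^ 2 * AZ)
      ≤ C' * Real.log Y := by
    rw [hC']
    have h0 : 0 ≤ 20 * σs ^ 2 * AZ := by positivity
    nlinarith
  linarith

/-- Non-vacuity of the K7′ predicate: the EMPTY configuration admits the trivial theft (`rem ≡ false`, `η = 0`,
`γ_k = k + 2`, `A = 3`) — as for pure sliding, a K7′ blindness `∃ Z, clauses ∧ theft` needs a genuine-tower
clause. -/
theorem removalSlidingTheft_emptyConfig (U : ℝ) {ηbar : ℝ} (hη : 0 ≤ ηbar) :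
    ∃ γ η : ℕ → ℝ, RemovalSlidingTheft U ηbar 3 emptyConfig γ η fun _ ↦ false :=
  removalSlidingTheft_of_boundedSlidingTheft (boundedSlidingTheft_emptyConfig U hη)

/-- **THE PRICE, INSTANTIATED** on the genuine tower `towerConfig` of §13 (one atom of weight `1` at `1/4 + i(n+1)`
for every `n`): ANY removal + sliding theft of it (window `U > 0`, slides `≤ η̄ ≤ 1/2`, any counting constant)
removes, for every `C`, finite sets of zeros of smoothed count `> C·log Y` at cofinally many heights `Y`. -/
theorem superlog_removal_towerConfig {U ηbar A : ℝ} (hU : 0 < U) (hηbar : ηbar ≤ 1 / 2) {γ η : ℕ → ℝ}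
    {rem : ℕ → Bool} (hT : RemovalSlidingTheft U ηbar A towerConfig γ η rem) (C Y₀ : ℝ) :
    ∃ Y : ℝ, Y₀ ≤ Y ∧ ∃ G : Finset ℕ, (∀ k ∈ G, rem k = true) ∧ C * Real.log Y < smoothCount γ Y G :=
  superlog_removal_of_removalSlidingTheft germHyp_towerConfig hU hηbar hT superlogTower_towerConfig C Y₀

end Summit.RiemannHypothesis.RiemannHypothesis.Theorems.Splittings.SlidingGerm
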